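import Mathlib
import HarnessLib

/-!
# Strict positivity of Riesz functionals gives representing measures (Fialkow–Nie 2010, Thm. 1.3)

Topic `Literature/MeasureTheory/Moments` (truncated multivariate moment problems; Mathlib has the
full moment machinery of `Mathlib.Probability.Moments` for random variables but nothing on the
TRUNCATED `K`-moment problem: searched `representing measure`, `Riesz functional`, `truncated
moment`, `Haviland`, `flat extension` — no hits in Mathlib or the tree, 2026-08-15).

L. Fialkow, J. Nie, *Positivity of Riesz functionals and solutions of quadratic and quartic moment
problems*, J. Funct. Anal. 258 (2010) 328–356 = arXiv:0908.3230, §1 (read from the held text,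
chunk p0003):

* a *truncated moment sequence* of degree `k` in `n` variables is a real multisequence
  `y = (y_α)_{α ∈ ℤ₊ⁿ, |α| ≤ k}`; for a closed `K ⊆ ℝⁿ` a *`K`-representing measure* is "a positive
  Borel measure `μ` on `ℝⁿ`, supported in `K`, such that `y_α = ∫ x^α dμ(x)` for all `|α| ≤ k`"
  (1.1);
* the *Riesz functional* `L_y : 𝒫_k → ℝ`, `L_y(p) = Σ_{|α| ≤ k} p_α y_α` on polynomials of degree
  at most `k`;
* "`L_y` is said to be `K`-positive if `L_y(p) ≥ 0` for all `p ∈ 𝒫_k`, `p|_K ≥ 0`. Further, `L_y`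
  is strictly `K`-positive if `L_y` is `K`-positive and `L_y(p) > 0` for all `p ∈ 𝒫_k`,
  `p|_K ≥ 0`, `p|_K ≢ 0`";
* "`K` is a determining set (of degree `k`) if whenever `p ∈ 𝒫_k` and `p|_K ≡ 0`, then `p ≡ 0`"
  (sets with nonempty interior are determining).

**Theorem 1.3.** "Suppose `K` is a determining set of degree `k` and let `y` be a truncated moment
sequence of degree `k` in `n` variables. If `L_y` is strictly `K`-positive, then `y` admits a
`K`-representing measure."

Vendored here AS PRINTED as a named fact (`def … : Prop`, review-queued, no proof; users take
`(h : FialkowNie2010_thm_1_3)`), over `MvPolynomial (Fin n) ℝ` (degree = `totalDegree`) and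
`MeasureTheory.Measure (Fin n → ℝ)` (Borel = product σ-algebra on `ℝⁿ`); "supported in `K`" is
`μ Kᶜ = 0`; the moment identities are stated with integrability of each monomial `x^α`, `|α| ≤ k`
(for `α = 0` this makes `μ` finite, as a representing measure of a truncated sequence must be).

Why it is here. The odd-degree specialisation is the "parity lemma" of route
`Summits/AnomalousDissipation/AnomalousDissipation/Theses/MomentParity` (cruxes `CubicParityLoud`,
`QuarticGate`): for `K = ℝⁿ` (determining) and ODD `k = 2d + 1`, a polynomial of degree `≤ 2d + 1`
that is nonnegative on `ℝⁿ` has degree `≤ 2d` (an odd leading form changes sign), so strict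
positivity of `L_y` only involves nonnegative polynomials of degree `≤ 2d`; for `d = 1` these are
sums of squares of affine functions (Hilbert; Fialkow–Nie p. 4, property `(H_{n,1})`), whence
**every degree-`3` truncated moment sequence whose moment matrix `M₁(y)` (moments of order `≤ 2`)
is positive definite has a representing measure on `ℝⁿ`** — third moments are unconstrained once
the covariance block is definite. That corollary is NOT vendored separately (it is a two-line
consequence, to be proved by whoever needs it); only the printed theorem is.
-/

namespace Literature.MeasureTheory.Moments

open _root_.MeasureTheory MvPolynomial
open scoped BigOperators

variable {n : ℕ}

/-- The **Riesz functional** `L_y(p) = Σ_α p_α · y_α` of a (truncated) multisequence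
`y : ℤ₊ⁿ → ℝ` on real polynomials in `n` variables (Fialkow–Nie 2010, §1; only the values `y_α`
with `α ∈ supp p` enter, so for `p ∈ 𝒫_k` only `|α| ≤ k` is used). [cite: FialkowNie2010, §1] -/
def rieszFunctional (y : (Fin n →₀ ℕ) → ℝ) (p : MvPolynomial (Fin n) ℝ) : ℝ :=
  ∑ α ∈ p.support, p.coeff α * y α

/-- `L_y` is **`K`-positive in degree `k`**: `L_y(p) ≥ 0` for every polynomial `p` of total degree
`≤ k` with `p|_K ≥ 0` (Fialkow–Nie 2010, §1). [cite: FialkowNie2010, §1] -/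
def IsKPositive (K : Set (Fin n → ℝ)) (k : ℕ) (y : (Fin n →₀ ℕ) → ℝ) : Prop :=
  ∀ p : MvPolynomial (Fin n) ℝ, p.totalDegree ≤ k → (∀ x ∈ K, 0 ≤ eval x p) →
    0 ≤ rieszFunctional y p

/-- `L_y` is **strictly `K`-positive in degree `k`**: it is `K`-positive and `L_y(p) > 0` for every
`p` of total degree `≤ k` with `p|_K ≥ 0` and `p|_K ≢ 0` (Fialkow–Nie 2010, §1).
[cite: FialkowNie2010, §1] -/
def IsStrictlyKPositive (K : Set (Fin n → ℝ)) (k : ℕ) (y : (Fin n →₀ ℕ) → ℝ) : Prop :=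
  IsKPositive K k y ∧
    ∀ p : MvPolynomial (Fin n) ℝ, p.totalDegree ≤ k → (∀ x ∈ K, 0 ≤ eval x p) →
      (∃ x ∈ K, eval x p ≠ 0) → 0 < rieszFunctional y p

/-- `K ⊆ ℝⁿ` is a **determining set of degree `k`**: a polynomial of total degree `≤ k` vanishing
identically on `K` is the zero polynomial (Fialkow–Nie 2010, §1; e.g. any `K` with nonempty
interior). [cite: FialkowNie2010, §1] -/
def IsDeterminingSet (K : Set (Fin n → ℝ)) (k : ℕ) : Prop :=
  ∀ p : MvPolynomial (Fin n) ℝ, p.totalDegree ≤ k → (∀ x ∈ K, eval x p = 0) → p = 0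

/-- `y` **admits a `K`-representing measure in degree `k`**: there is a (positive, Borel) measure
`μ` on `ℝⁿ` supported in `K` (`μ Kᶜ = 0`) all of whose moments of order `≤ k` exist and equal the
prescribed ones, `∫ x^α dμ = y_α` for `|α| ≤ k` (Fialkow–Nie 2010, (1.1)); `x^α = ∏ᵢ xᵢ^{αᵢ}`.
[cite: FialkowNie2010, §1 (1.1)] -/
def HasRepresentingMeasure (K : Set (Fin n → ℝ)) (k : ℕ) (y : (Fin n →₀ ℕ) → ℝ) : Prop :=
  ∃ μ : Measure (Fin n → ℝ), μ Kᶜ = 0 ∧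
    ∀ α : Fin n →₀ ℕ, (α.sum fun _ e => e) ≤ k →
      Integrable (fun x : Fin n → ℝ => ∏ i, x i ^ α i) μ ∧
        ∫ x, (∏ i, x i ^ α i) ∂μ = y α

/-- **Fialkow–Nie 2010, Theorem 1.3.** Let `K ⊆ ℝⁿ` be closed and a determining set of degree
`k`, and let `y` be a truncated moment sequence of degree `k` in `n` variables. If the Riesz
functional `L_y` is strictly `K`-positive (on polynomials of degree `≤ k`), then `y` admits a
`K`-representing measure. (Proved there from the closure theorem Thm. 2.2: `L_y` is `K`-positive
iff `y` is a limit of sequences having `K`-representing measures, plus a convexity/interior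
argument, §2.) Grounds the parity step ("odd-order realizability is vacuous once the covariance is
definite") of `Summit.AnomalousDissipation.AnomalousDissipation.Theses.MomentParity.CubicParityLoud`
(and the realizability side of `…MomentParity.QuarticGate`): in odd degree `k = 3` with `K = ℝⁿ`,
positive definiteness of the order-`≤ 2` moment matrix already gives a representing measure (see
the module docstring). Named fact, no proof here. [cite: FialkowNie2010, Thm. 1.3] -/
def FialkowNie2010_thm_1_3 : Prop :=
  ∀ (n k : ℕ) (K : Set (Fin n → ℝ)) (y : (Fin n →₀ ℕ) → ℝ),
    IsClosed K → IsDeterminingSet K k → IsStrictlyKPositive K k y → HasRepresentingMeasure K k y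

/-- Sanity check of the vocabulary (not part of the printed theorem): the Riesz functional of the
monomial `x^α` is the prescribed moment `y_α`. [folklore] -/
theorem rieszFunctional_monomial (y : (Fin n →₀ ℕ) → ℝ) (α : Fin n →₀ ℕ) :
    rieszFunctional y (monomial α (1 : ℝ)) = y α := by
  classical
  simp [rieszFunctional, MvPolynomial.support_monomial, MvPolynomial.coeff_monomial]

end Literature.MeasureTheory.Moments

/-!
## Proof of Theorem 1.3 (`FialkowNie2010_thm_1_3_holds`)

Fialkow–Nie prove Thm. 1.3 (restated as Thm. 2.4, §2 of the paper) by convex geometry in the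
finite-dimensional moment space `ℝ^η`, `η = dim 𝒫_k`: with `R = R_{n,k}(K)` the convex cone of
sequences having `K`-representing measures (equal, by Bayer–Teichmann, to the cone `F_{n,k}(K)`
of sequences with FINITELY ATOMIC `K`-representing measures, i.e. the conic hull of the moment
vectors `[x]_k = (x^α)_{|α| ≤ k}`, `x ∈ K`), they show: `K`-positivity `⟹ y ∈ cl R` (Minkowski
separation, Thm. 2.2); strict `K`-positivity is an open condition (Lemma 2.3), so
`y ∈ int (cl R)`; and `int (cl R) = int R ⊆ R` for convex `R` (Lemma 2.1).

The formal proof below is the same convex-geometric argument, arranged so that only ONE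
separation is needed and neither closures nor Bayer–Teichmann enter: we work directly with the
conic hull `C` (`PointedCone.hull`) of the moment vectors `[x]_k`, `x ∈ K` — membership of `ŷ`
in `C` literally is a finitely atomic `K`-representing measure.
* `K` determining `⟹` the moment vectors span `ℝ^η` (a nonzero functional vanishing on them is
  a nonzero polynomial of degree `≤ k` vanishing on `K`) `⟹ int C ≠ ∅`
  (`Convex.interior_nonempty_iff_affineSpan_eq_top`).
* If `ŷ ∉ C` then `ŷ ∉ int C`, and the supporting-hyperplane form of Hahn–Banach
  (`geometric_hahn_banach_of_nonempty_interior_point`) gives `f ≠ 0` with `f ≤ f(ŷ)` on `C`;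
  as `C` is a cone, `f ≤ 0` on `C` and `0 ≤ f(ŷ)`. The polynomial `p` with coefficient vector
  `-f` has `p|_K ≥ 0`, `p ≠ 0` (so `p|_K ≢ 0`, `K` being determining), `deg p ≤ k`, and
  `L_y(p) = -f(ŷ) ≤ 0` — contradicting strict `K`-positivity.
(The closedness hypothesis on `K` is not used.)
-/

namespace Literature.MeasureTheory.Moments

open _root_.MeasureTheory MvPolynomial
open scoped BigOperators ENNReal

section RieszLinearity

variable {n : ℕ}

/-- `L_y(p)` may be computed over any finite set of exponents containing `supp p`. [folklore] -/
theorem rieszFunctional_eq_sum_of_subset (y : (Fin n →₀ ℕ) → ℝ) (p : MvPolynomial (Fin n) ℝ)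
    {s : Finset (Fin n →₀ ℕ)} (hs : p.support ⊆ s) :
    rieszFunctional y p = ∑ α ∈ s, p.coeff α * y α := by
  unfold rieszFunctional
  refine Finset.sum_subset hs ?_
  intro α _ hα
  rw [notMem_support_iff.mp hα, zero_mul]

/-- Additivity of the Riesz functional in the polynomial. [folklore] -/
theorem rieszFunctional_add (y : (Fin n →₀ ℕ) → ℝ) (p q : MvPolynomial (Fin n) ℝ) :
    rieszFunctional y (p + q) = rieszFunctional y p + rieszFunctional y q := by
  rw [rieszFunctional_eq_sum_of_subset y (p + q) support_add,
    rieszFunctional_eq_sum_of_subset y p Finset.subset_union_left,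
    rieszFunctional_eq_sum_of_subset y q Finset.subset_union_right, ← Finset.sum_add_distrib]
  refine Finset.sum_congr rfl fun α _ => ?_
  rw [coeff_add, add_mul]

/-- The Riesz functional of a finite sum of polynomials. [folklore] -/
theorem rieszFunctional_finsetSum (y : (Fin n →₀ ℕ) → ℝ) {κ : Type*} (s : Finset κ)
    (F : κ → MvPolynomial (Fin n) ℝ) :
    rieszFunctional y (∑ i ∈ s, F i) = ∑ i ∈ s, rieszFunctional y (F i) := by
  induction s using Finset.cons_induction with
  | empty => simp [rieszFunctional]
  | cons a s ha ih => rw [Finset.sum_cons, Finset.sum_cons, rieszFunctional_add, ih]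

/-- `L_y(c x^α) = c y_α`. [folklore] -/
theorem rieszFunctional_monomial' (y : (Fin n →₀ ℕ) → ℝ) (α : Fin n →₀ ℕ) (c : ℝ) :
    rieszFunctional y (monomial α c) = c * y α := by
  classical
  by_cases hc : c = 0
  · subst hc
    simp [rieszFunctional]
  · simp [rieszFunctional, support_monomial, hc]

end RieszLinearity

namespace FialkowNie2010

/-! ### Polynomials `Σ_i c_i x^{e i}` over a finite family of exponents `e : ι → ℤ₊ⁿ` -/

variable {n : ℕ} {ι : Type*} [Fintype ι] (e : ι → (Fin n →₀ ℕ))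

/-- Evaluation of `Σ_i c_i x^{e i}` at a point: `Σ_i c_i ∏_j x_j^{(e i)_j}`. [folklore] -/
theorem eval_sum_monomial (c : ι → ℝ) (x : Fin n → ℝ) :
    eval x (∑ i, monomial (e i) (c i)) = ∑ i, c i * ∏ j, x j ^ (e i) j := by
  rw [map_sum]
  refine Finset.sum_congr rfl fun i _ => ?_
  rw [eval_monomial, Finsupp.prod_fintype _ _ fun j => pow_zero (x j)]

/-- `Σ_i c_i x^{e i}` has total degree `≤ k` when every `|e i| ≤ k`. [folklore] -/
theorem totalDegree_sum_monomial_le (c : ι → ℝ) {k : ℕ}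
    (hek : ∀ i, ((e i).sum fun _ m => m) ≤ k) : (∑ i, monomial (e i) (c i)).totalDegree ≤ k :=
  totalDegree_finsetSum_le fun i _ => (totalDegree_monomial_le _ _).trans (hek i)

/-- `L_y(Σ_i c_i x^{e i}) = Σ_i c_i y_{e i}`. [folklore] -/
theorem rieszFunctional_sum_monomial (y : (Fin n →₀ ℕ) → ℝ) (c : ι → ℝ) :
    rieszFunctional y (∑ i, monomial (e i) (c i)) = ∑ i, c i * y (e i) := by
  rw [rieszFunctional_finsetSum]
  refine Finset.sum_congr rfl fun i _ => ?_
  rw [rieszFunctional_monomial']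

variable {e}

/-- For an injective family of exponents, the `x^{e i}`-coefficient of `Σ_i' c_i' x^{e i'}` is
`c_i`. [folklore] -/
theorem coeff_sum_monomial (he : Function.Injective e) (c : ι → ℝ) (i : ι) :
    (∑ i', monomial (e i') (c i')).coeff (e i) = c i := by
  classical
  simp [coeff_sum, coeff_monomial, he.eq_iff]

/-- For an injective family of exponents, `Σ_i c_i x^{e i} = 0` forces `c = 0` (linear
independence of distinct monomials). [folklore] -/
theorem eq_zero_of_sum_monomial_eq_zero (he : Function.Injective e) {c : ι → ℝ}
    (h : ∑ i, monomial (e i) (c i) = 0) (i : ι) : c i = 0 := by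
  rw [← coeff_sum_monomial he c i, h, coeff_zero]

/-! ### The conic hull of the moment vectors contains `ŷ` -/

/-- Core of Fialkow–Nie Thm. 1.3: for an injective finite family `e` of exponents of degree
`≤ k`, a determining `K` and a strictly `K`-positive `L_y`, the vector `ŷ = (y_{e i})_i` lies in
the conic hull of the moment vectors `[x] = (x^{e i})_i`, `x ∈ K` — i.e. `y` has a finitely
atomic `K`-representing measure on these exponents. [cite: FialkowNie2010, Thm. 2.4 & §2] -/
theorem mem_hull_momentVectors (he : Function.Injective e) {k : ℕ}
    (hek : ∀ i, ((e i).sum fun _ m => m) ≤ k) {K : Set (Fin n → ℝ)} {y : (Fin n →₀ ℕ) → ℝ}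
    (hdet : IsDeterminingSet K k) (hpos : IsStrictlyKPositive K k y) :
    (fun i => y (e i)) ∈
      PointedCone.hull ℝ ((fun (x : Fin n → ℝ) (i : ι) => ∏ j, x j ^ (e i) j) '' K) := by
  classical
  set v : (Fin n → ℝ) → ι → ℝ := fun x i => ∏ j, x j ^ (e i) j with hv
  set C : PointedCone ℝ (ι → ℝ) := PointedCone.hull ℝ (v '' K) with hCdef
  have hconv : Convex ℝ (C : Set (ι → ℝ)) := C.convex
  have hvC : ∀ x ∈ K, v x ∈ C := fun x hx => PointedCone.subset_hull ⟨x, hx, rfl⟩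
  -- a linear functional `f` on `ι → ℝ` is `w ↦ Σ_i f(δ_i) w_i`
  have key : ∀ (f : (ι → ℝ) →ₗ[ℝ] ℝ) (w : ι → ℝ),
      f w = ∑ i, (f fun j => if i = j then 1 else 0) * w i := fun f w => by
    rw [LinearMap.pi_apply_eq_sum_univ f w]
    simp_rw [smul_eq_mul, mul_comm]
  -- the polynomial `P f = Σ_i f(δ_i) x^{e i}` attached to `f`
  set P : ((ι → ℝ) →ₗ[ℝ] ℝ) → MvPolynomial (Fin n) ℝ :=
    fun f => ∑ i, monomial (e i) (f fun j => if i = j then 1 else 0) with hPdef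
  have hPeval : ∀ (f : (ι → ℝ) →ₗ[ℝ] ℝ) (x : Fin n → ℝ), eval x (P f) = f (v x) :=
    fun f x => by
    rw [key f (v x), hPdef, eval_sum_monomial]
  have hPdeg : ∀ f : (ι → ℝ) →ₗ[ℝ] ℝ, (P f).totalDegree ≤ k := fun f =>
    totalDegree_sum_monomial_le e _ hek
  have hPriesz : ∀ f : (ι → ℝ) →ₗ[ℝ] ℝ, rieszFunctional y (P f) = f (fun i => y (e i)) :=
    fun f => by
    rw [key f, hPdef, rieszFunctional_sum_monomial]
  have hPzero : ∀ f : (ι → ℝ) →ₗ[ℝ] ℝ, P f = 0 → f = 0 := fun f h => by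
    refine LinearMap.ext fun w => ?_
    rw [key f w, LinearMap.zero_apply]
    exact Finset.sum_eq_zero fun i _ => by rw [eq_zero_of_sum_monomial_eq_zero he h i, zero_mul]
  -- (a) `K` determining ⟹ the moment vectors span everything ...
  have hspan : Submodule.span ℝ (v '' K) = ⊤ := by
    by_contra hne
    obtain ⟨F, hF0, hle⟩ := Submodule.exists_le_ker_of_lt_top _ (lt_top_iff_ne_top.mpr hne)
    refine hF0 (hPzero F (hdet _ (hPdeg F) fun x hx => ?_))
    rw [hPeval]
    exact LinearMap.mem_ker.mp (hle (Submodule.subset_span ⟨x, hx, rfl⟩))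
  -- ... ⟹ `int C ≠ ∅`
  have hint : (interior (C : Set (ι → ℝ))).Nonempty := by
    rw [hconv.interior_nonempty_iff_affineSpan_eq_top,
      AffineSubspace.affineSpan_eq_top_iff_vectorSpan_eq_top_of_nonempty ℝ _ _
        ⟨0, C.zero_mem⟩, vectorSpan_def, eq_top_iff, ← hspan]
    refine Submodule.span_mono ?_
    rintro _ ⟨x, hx, rfl⟩
    exact ⟨v x, hvC x hx, 0, C.zero_mem, by simp⟩
  -- (b) separation: if `ŷ ∉ C` a nonzero functional attains its max over `C` at `ŷ`
  by_contra hy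
  have hy' : (fun i => y (e i)) ∉ interior (C : Set (ι → ℝ)) := fun h => hy (interior_subset h)
  obtain ⟨f, hf0, hf⟩ := geometric_hahn_banach_of_nonempty_interior_point hconv hy' hint
  have hfy : 0 ≤ f (fun i => y (e i)) := by simpa using hf 0 C.zero_mem
  -- `C` is a cone, so `f ≤ 0` on `C`
  have hfC : ∀ a ∈ C, f a ≤ 0 := by
    intro a ha
    by_contra hfa
    push Not at hfa
    have hmem : ((f (fun i => y (e i)) + 1) / f a) • a ∈ C :=
      C.smul_mem (div_nonneg (by linarith) hfa.le) ha
    have h := hf _ hmem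
    rw [map_smul, smul_eq_mul, div_mul_cancel₀ _ hfa.ne'] at h
    linarith
  -- the polynomial with coefficient vector `-f`
  set F : (ι → ℝ) →ₗ[ℝ] ℝ := -(f : (ι → ℝ) →ₗ[ℝ] ℝ) with hF
  have hFapply : ∀ w, F w = -f w := fun w => by simp [hF]
  have hFne : F ≠ 0 := by
    intro h
    apply hf0
    ext w
    have := hFapply w
    rw [h, LinearMap.zero_apply] at this
    have hw0 : f w = 0 := by linarith
    simp [hw0]
  have hPne : P F ≠ 0 := fun h => hFne (hPzero F h)
  have hPnonneg : ∀ x ∈ K, 0 ≤ eval x (P F) := by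
    intro x hx
    rw [hPeval, hFapply, Left.nonneg_neg_iff]
    exact hfC _ (hvC x hx)
  have hPnz : ∃ x ∈ K, eval x (P F) ≠ 0 := by
    by_contra h
    push Not at h
    exact hPne (hdet _ (hPdeg F) h)
  have hlt := hpos.2 _ (hPdeg F) hPnonneg hPnz
  rw [hPriesz, hFapply] at hlt
  linarith

end FialkowNie2010

/-- **Fialkow–Nie 2010, Theorem 1.3** holds: for a determining set `K` of degree `k`, strict
`K`-positivity of `L_y` on `𝒫_k` gives a (finitely atomic) `K`-representing measure for `y`.
Proof: the convex-geometric argument of [cite: FialkowNie2010, §2: Thm. 2.4 (= Thm. 1.3),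
Thm. 2.2, Lemma 2.1] in the moment space `ℝ^η` (see the section docstring above and
`FialkowNie2010.mem_hull_momentVectors`), followed by reading a conic combination
`ŷ = Σ cᵢ [xᵢ]_k`, `cᵢ ≥ 0`, `xᵢ ∈ K`, as the measure `Σ cᵢ δ_{xᵢ}`. -/
theorem FialkowNie2010_thm_1_3_holds : FialkowNie2010_thm_1_3 := by
  intro n k K y _hK hdet hpos
  classical
  -- the finite set `D` of exponents of degree `≤ k`
  have hfin : {α : Fin n →₀ ℕ | Finsupp.degree α ≤ k}.Finite := Finsupp.finite_of_degree_le k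
  set D : Finset (Fin n →₀ ℕ) := hfin.toFinset with hD
  have hmem : ∀ α : Fin n →₀ ℕ, α ∈ D ↔ (α.sum fun _ m => m) ≤ k := fun α => by
    rw [hD, Set.Finite.mem_toFinset, Set.mem_setOf_eq, Finsupp.degree_apply]
    rfl
  have hek : ∀ i : D, ((i : Fin n →₀ ℕ).sum fun _ m => m) ≤ k := fun i => (hmem i).mp i.2
  -- `ŷ` is a conic combination of moment vectors of points of `K`
  have h := FialkowNie2010.mem_hull_momentVectors (e := fun i : D => (i : Fin n →₀ ℕ))
    Subtype.val_injective hek hdet hpos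
  rw [PointedCone.mem_hull_set] at h
  obtain ⟨c, hcsupp, hc0, hcsum⟩ := h
  have hpt : ∀ w ∈ c.support, ∃ x ∈ K,
      (fun i : D => ∏ j, x j ^ (i : Fin n →₀ ℕ) j) = w := fun w hw => hcsupp hw
  choose! pt hptK hptv using hpt
  -- the finitely atomic measure `Σ_w c_w δ_{pt w}`
  refine ⟨∑ w ∈ c.support, ENNReal.ofReal (c w) • Measure.dirac (pt w), ?_, ?_⟩
  · rw [Measure.finsetSum_apply]
    refine Finset.sum_eq_zero fun w hw => ?_
    have hw' : pt w ∉ Kᶜ := fun h => h (hptK w hw)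
    simp [Measure.dirac_apply, Set.indicator_of_notMem hw']
  · intro α hα
    have hint : ∀ w ∈ c.support, Integrable (fun x : Fin n → ℝ => ∏ i, x i ^ α i)
        (ENNReal.ofReal (c w) • Measure.dirac (pt w)) := fun w _ =>
      ((integrable_const _).congr (ae_eq_dirac _).symm).smul_measure ENNReal.ofReal_ne_top
    refine ⟨integrable_finsetSum_measure.mpr hint, ?_⟩
    rw [integral_finsetSum_measure hint]
    simp_rw [integral_smul_measure, integral_dirac]
    have hyα := congr_fun hcsum ⟨α, (hmem α).mpr hα⟩
    simp only [Finsupp.sum, Finset.sum_apply, Pi.smul_apply, smul_eq_mul] at hyα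
    rw [← hyα]
    refine Finset.sum_congr rfl fun w hw => ?_
    have hw' : ∏ j, pt w j ^ α j = w ⟨α, (hmem α).mpr hα⟩ :=
      congr_fun (hptv w hw) ⟨α, (hmem α).mpr hα⟩
    rw [ENNReal.toReal_ofReal (hc0 w), smul_eq_mul, ← hw']

end Literature.MeasureTheory.Moments
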